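import Literature.AlgebraicGeometry.Resolution.TameTowerPGroupTowers
import Literature.AlgebraicGeometry.Resolution.TameTowerInertiaUnramified
import Literature.AlgebraicGeometry.Resolution.TameTowerInertiaPGroup
import Literature.AlgebraicGeometry.Resolution.HenselizationImmediateProofs
import Literature.AlgebraicGeometry.Resolution.GeneralizedStabilityRankOneVTPairs
import Mathlib.FieldTheory.Normal.Closure
import Mathlib.RingTheory.RootsOfUnity.AlgebraicallyClosed
import HarnessLib

/-!
# Proof of the reduction to a tame tower (Kuhlmann 2010, §5, pp. 18–19, with Lemma 2.27)

Topic: `Literature/AlgebraicGeometry/Resolution` (valued function fields). DISCHARGE of the named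
fact `Kuhlmann2010TameTowerReduction` (`HenselizedFunctionFields.lean`) = F.-V. Kuhlmann,
*Elimination of ramification I: The generalized stability theorem*, Trans. AMS 362 (2010)
5697–5727 = arXiv:1003.5678, §5, proof of (R4), p. 18 l. −9 – p. 19 l. 3:

> Since the ramification group is a `p`-group (cf. [En]), `F^sep|F^r` is a `p`-extension. It
> follows from the general theory of `p`-groups (cf. [H], Chapter III, §7, Satz 7.2 and the
> following remark) via Galois correspondence that the maximal separable subextension of
> `E.F^r|F^r` is a finite tower of Galois extensions of degree `p`. Consequently, `E.F^r|F^r` is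
> a finite tower of normal extensions of degree `p`, either Galois or purely inseparable. Then
> there is already a finite subextension `N|F` of `F^r|F` such that `E.N|N` is such a tower.

with Lemma 2.27, Case II ("`vF = vK` is divisible, and since `vE/vF` is finite, `vE = vF`. Hence
`(E|F,v)` is unramified"). The proof formalized here runs at the level of FINITE Galois theory
and never constructs `F^r`: let `E₁` be the normal closure of `E|F` inside `Ω`, `L ≤ E₁` the
separable closure of `F` in `E₁` (finite Galois over `F`), `G = Gal(L|F)`. Since `F` is henselian
(`IsHenselizedInertiallyGeneratedRT.isHenselianField`), `V ∩ L` is the only extension of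
`V ∩ F`, so `V` is stable under `G` and the inertia group `I ≤ G` is defined
(`TameTowerInertiaField.lean`). Its fixed field `T = L^I` is the `N` of the source:

1. `vF = vK` is divisible (`IsHenselizedInertiallyGeneratedRT.exists_valuation_eq`: `F|K(x)^h`
   unramified, `K(x)^h|K(x)` immediate — `Kuhlmann2010HenselizationImmediate_holds` —, and
   `vK(x) = vK` by Lemma 2.5), so every algebraic extension of `F` inside `Ω` has value group
   `vF` (`…exists_valuation_eq_of_isAlgebraic`): there is no tame ramification, and `I` is a
   `p`-group (`isPGroup_of_inertia`, `TameTowerInertiaPGroup.lean`; the roots of unity of order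
   prime to `p` lie in the algebraically closed `K ≤ F`). This is "the ramification group is a
   `p`-group" in the form needed: here `I` IS the ramification group.
2. Hence `T|F` is unramified (`isUnramifiedOver_fixedField_inertia`,
   `TameTowerInertiaUnramified.lean`) — Lemma 2.27 for `N = T`.
3. `L|T` is Galois with Galois group the `p`-group `I`, so its intermediate field
   `S₂ = L ∩ E.T` is reached from `T` by a tower of Galois extensions of degree `p`
   (`isNormalPTower_of_isGalois_of_isPGroup`, `TameTowerPGroupTowers.lean`: "general theory of
   `p`-groups … via Galois correspondence"); and `E.T|S₂` is purely inseparable (`E₁|L` is),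
   hence a tower of purely inseparable extensions of degree `p`
   (`isNormalPTower_of_forall_pow_mem`).

## Content (everything PROVED)

* `IsHenselizedInertiallyGeneratedRT.base_le`,
  `exists_valuation_eq_of_mem_adjoin_residueTranscendental` (Lemma 2.5: `vK(x) = vK`),
  `IsHenselizedInertiallyGeneratedRT.exists_valuation_eq` (`vF = vK`),
  `IsHenselizedInertiallyGeneratedRT.exists_valuation_eq_of_isAlgebraic` (Lemma 2.27, Case II).
* `natCast_ne_zero_of_ne_residueChar`, `eq_residueChar_of_charP`,
  `exists_isPrimitiveRoot_of_isAlgClosed` — characteristic bookkeeping and roots of unity.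
* `forall_mem_iff_of_isHenselianField` — `V` is stable under `Gal(L|F)` over a henselian `F`.
* `Kuhlmann2010TameTowerReduction_holds` — the discharge.

## Sources

* F.-V. Kuhlmann, loc. cit., §1.1, §2.1 (Lemma 2.2, Lemma 2.5), §2.5 (Lemma 2.27), §5 (proof of
  (R4), pp. 18–19). [En] = O. Endler, *Valuation theory* (1972), §20; [H] = B. Huppert,
  *Endliche Gruppen I* (1967), III §7.
-/

noncomputable section

open Module IntermediateField IsLocalRing

namespace Literature.AlgebraicGeometry.Resolution

universe u

variable {Ω : Type u} [Field Ω] (V : ValuationSubring Ω)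

/-! ### The value group of a field of the class is the divisible group `vK` -/

/-- `K ≤ F` for a field `F` of the class over `K`. [cite: Kuhlmann2010, Section 2.5] -/
theorem IsHenselizedInertiallyGeneratedRT.base_le {K F : Subfield Ω}
    (hF : IsHenselizedInertiallyGeneratedRT V K F) : K ≤ F := by
  obtain ⟨x, -, -, hunr⟩ := hF
  exact ((subfield_le_toSubfield (IntermediateField.adjoin K ({x} : Set Ω))).trans
    (le_henselization V _)).trans hunr.le

/-- **Kuhlmann 2010, Lemma 2.5 / Gauss: `vK(x) = vK` for `x` residue-transcendental over `K`**:
every non-zero element of `K(x)` has the value of an element of `K` (Knaf–Kuhlmann 2005, Thm. 2.1,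
`exists_valuation_eq_of_mem_closure`, with no value-transcendental and one residue-transcendental
generator). PROVED. [cite: Kuhlmann2010, Lemma 2.5] -/
theorem exists_valuation_eq_of_mem_adjoin_residueTranscendental {K : Subfield Ω} {x : Ω}
    (hx : IsResidueTranscendental V K x) {a : Ω}
    (ha : a ∈ (IntermediateField.adjoin K ({x} : Set Ω)).toSubfield) (ha0 : a ≠ 0) :
    ∃ b ∈ K, V.valuation a = V.valuation b := by
  obtain ⟨hxV, htr⟩ := hx
  have hx0 : ∀ i : Empty, (Empty.elim i : Ω) ≠ 0 := fun i => i.elim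
  have hxi : ∀ m : Empty → ℤ,
      (∃ b ∈ K, (∏ i, V.valuation ((fun j : Empty => (Empty.elim j : Ω)) i) ^ (m i)) =
        V.valuation b) → m = 0 := fun m _ => funext fun i => i.elim
  have hy : ∀ j : Unit, ((fun _ : Unit => x) j) ∈ V := fun _ => hxV
  have hri : AlgebraicIndependent (resField V K) (fun j : Unit => residue V ⟨x, hy j⟩) :=
    algebraicIndependent_unique_type_iff.mpr htr
  have ha' : a ∈ Subfield.closure ((K : Set Ω) ∪
      (Set.range (fun j : Empty => (Empty.elim j : Ω)) ∪ Set.range (fun _ : Unit => x))) := by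
    rw [Set.range_const, Set.range_eq_empty, Set.empty_union, ← adjoin_toSubfield_eq_closure]
    exact ha
  obtain ⟨m, b, hb, hab⟩ := exists_valuation_eq_of_mem_closure V K hx0 hxi hy hri ha' ha0
  refine ⟨b, hb, ?_⟩
  simpa using hab

/-- **`vF = vK` for a field `F` of the class** (Kuhlmann 2010, Lemma 2.27, Case II / §2.5:
"`vF = vK(x)` by Lemma 2.5" — `F|K(x)^h` is unramified, `K(x)^h|K(x)` is immediate (Lemma 2.2),
and `vK(x) = vK`): every non-zero element of `F` has the value of an element of `K`. PROVED
(`Kuhlmann2010HenselizationImmediate_holds`,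
`exists_valuation_eq_of_mem_adjoin_residueTranscendental`).
[cite: Kuhlmann2010, Lemma 2.27 and Section 2.5] -/
theorem IsHenselizedInertiallyGeneratedRT.exists_valuation_eq [IsAlgClosed Ω] {K F : Subfield Ω}
    (hF : IsHenselizedInertiallyGeneratedRT V K F) {b : Ω} (hb : b ∈ F) (hb0 : b ≠ 0) :
    ∃ c ∈ K, V.valuation b = V.valuation c := by
  obtain ⟨x, hrt, -, hunr⟩ := hF
  set Kx : Subfield Ω := (IntermediateField.adjoin K ({x} : Set Ω)).toSubfield with hKx
  -- `v(b) ∈ vF = v(K(x)^h) = vK(x)`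
  have hγ : Units.mk0 (V.valuation b) ((_root_.map_ne_zero _).mpr hb0) ∈ valueSubgroup F V :=
    (mem_valueSubgroup_iff F V _).mpr ⟨⟨b, hb⟩, fun h => hb0 (congrArg Subtype.val h), rfl⟩
  rw [hunr.2.2.2.2, (IsImmediateOver.valueSubgroup_eq_and_residueSubfield_eq V
    (le_henselization V Kx) (Kuhlmann2010HenselizationImmediate_holds Ω V Kx)).1] at hγ
  obtain ⟨a, ha0, hγa⟩ := (mem_valueSubgroup_iff Kx V _).mp hγ
  have ha0' : (a : Ω) ≠ 0 := fun h => ha0 (Subtype.ext h)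
  -- `vK(x) = vK`
  obtain ⟨c, hc, hac⟩ := exists_valuation_eq_of_mem_adjoin_residueTranscendental V hrt a.2 ha0'
  refine ⟨c, hc, ?_⟩
  rw [← hac]
  exact hγa

/-- **Values of algebraic elements over a field of the class are values of `K`** (Lemma 2.27,
Case II: "`vF = vK` is divisible, and since `vE/vF` is finite, `vE = vF`"): for `y ∈ Ω^×`
algebraic over `F`, `v(y)^n ∈ vF = vK` for some `n ≥ 1`
(`exists_valuation_pow_eq_of_isAlgebraic`),
`vK` is divisible (`K` algebraically closed) and `vΩ` is torsion free. PROVED.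
[cite: Kuhlmann2010, Lemma 2.27] -/
theorem IsHenselizedInertiallyGeneratedRT.exists_valuation_eq_of_isAlgebraic [IsAlgClosed Ω]
    {K F : Subfield Ω} (hK : IsAlgClosed K) (hF : IsHenselizedInertiallyGeneratedRT V K F)
    {y : Ω} (hy : IsAlgebraic F y) (hy0 : y ≠ 0) :
    ∃ c ∈ K, V.valuation y = V.valuation c := by
  obtain ⟨n, hn, b, hb, hyb⟩ := exists_valuation_pow_eq_of_isAlgebraic V hy hy0
  have hb0 : b ≠ 0 := by
    rintro rfl
    rw [map_zero, map_pow, pow_eq_zero_iff hn, map_eq_zero] at hyb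
    exact hy0 hyb
  obtain ⟨c, hc, hbc⟩ := hF.exists_valuation_eq V hb hb0
  obtain ⟨d, hd⟩ := IsAlgClosed.exists_pow_nat_eq (⟨c, hc⟩ : K) (Nat.pos_of_ne_zero hn)
  have hd' : (d : Ω) ^ n = c := by
    have := congrArg (fun t : K => (t : Ω)) hd
    simpa using this
  refine ⟨d, d.2, valuation_eq_of_pow_eq V hn ?_⟩
  rw [← map_pow, ← map_pow, hd', hyb, hbc]

/-! ### Roots of unity; the residue characteristic and the characteristic of `Ω` -/

/-- If `char Ωv = p` then a prime `ℓ ≠ p` is non-zero in `Ω`. [folklore] -/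
theorem natCast_ne_zero_of_ne_residueChar {p : ℕ} (hp : p.Prime) [CharP (ResidueField V) p]
    {ℓ : ℕ} (hℓ : ℓ.Prime) (hℓp : ℓ ≠ p) : (ℓ : Ω) ≠ 0 := by
  intro h0
  have h1 : (ℓ : V) = 0 := Subtype.ext (by push_cast; exact h0)
  have h2 : (ℓ : ResidueField V) = 0 := by
    rw [← map_natCast (residue V), h1, map_zero]
  rw [CharP.cast_eq_zero_iff (ResidueField V) p] at h2
  exact hℓp ((Nat.prime_dvd_prime_iff_eq hp hℓ).mp h2).symm

/-- If `char Ωv = p` and `char Ω = q > 0` … more precisely: a prime `q` with `CharP Ω q` is the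
residue characteristic. [folklore] -/
theorem eq_residueChar_of_charP {p : ℕ} (hp : p.Prime) [CharP (ResidueField V) p]
    {q : ℕ} (hq : q.Prime) [CharP Ω q] : q = p := by
  by_contra hne
  exact natCast_ne_zero_of_ne_residueChar V hp hq hne (CharP.cast_eq_zero Ω q)

/-- **Roots of unity of order prime to the residue characteristic in an algebraically closed
subfield**: for `K ≤ F ≤ Ω` with `K` algebraically closed and `char Ωv = p`, `F` contains a
primitive `ℓ`-th root of unity for every prime `ℓ ≠ p`. [folklore] -/
theorem exists_isPrimitiveRoot_of_isAlgClosed {p : ℕ} (hp : p.Prime) [CharP (ResidueField V) p]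
    {K F : Subfield Ω} (hK : IsAlgClosed K) (hKF : K ≤ F) {ℓ : ℕ} (hℓ : ℓ.Prime)
    (hℓp : ℓ ≠ p) : ∃ ζ : F, IsPrimitiveRoot ζ ℓ := by
  haveI : NeZero (ℓ : K) := ⟨fun h => natCast_ne_zero_of_ne_residueChar V hp hℓ hℓp (by
    have := congrArg (fun t : K => (t : Ω)) h
    simpa using this)⟩
  obtain ⟨ζ, hζ⟩ := HasEnoughRootsOfUnity.exists_primitiveRoot K ℓ
  exact ⟨Subfield.inclusion hKF ζ, hζ.map_of_injective (Subfield.inclusion hKF).injective⟩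

/-! ### Stability of `V` under the Galois group over a henselian subfield -/

/-- **Over a henselian `(F, V ∩ F)`, `V` is stable under `Gal(L|F)` for every algebraic `L|F`
inside `Ω`**: `σ⁻¹(V ∩ L)` and `V ∩ L` are valuation rings of `L` over `V ∩ F`, hence
equal (uniqueness of the extension, `IsHenselianField`). [cite: Kuhlmann2010, Section 1.1] -/
theorem forall_mem_iff_of_isHenselianField {F : Subfield Ω}
    (hF : IsHenselianField F (V.comap (algebraMap F Ω))) (L : IntermediateField F Ω)
    [Algebra.IsAlgebraic F L] (σ : L ≃ₐ[F] L) (x : L) :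
    (x : Ω) ∈ V ↔ ((σ x : L) : Ω) ∈ V := by
  let O₁ : ValuationSubring L := V.comap (algebraMap L Ω)
  let O₂ : ValuationSubring L := O₁.comap (σ : L →+* L)
  have h₁ : O₁.comap (algebraMap F L) = V.comap (algebraMap F Ω) := by
    rw [ValuationSubring.comap_comap, ← IsScalarTower.algebraMap_eq]
  have hcomp : (σ : L →+* L).comp (algebraMap F L) = algebraMap F L :=
    RingHom.ext fun c => σ.commutes c
  have h₂ : O₂.comap (algebraMap F L) = V.comap (algebraMap F Ω) := by
    rw [← h₁]
    change (O₁.comap (σ : L →+* L)).comap (algebraMap F L) = O₁.comap (algebraMap F L)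
    rw [ValuationSubring.comap_comap, hcomp]
  have h := hF.eq_of_comap_eq (O₁ := O₁) (O₂ := O₂) h₁ h₂
  have hx : x ∈ O₁ ↔ x ∈ O₂ := by rw [h]
  exact hx


/-! ### The discharge -/

/-- From `ExpChar R q` with `q` prime to `CharP R q`. [folklore] -/
theorem charP_of_expChar_of_prime {R : Type*} [Ring R] (q : ℕ) [h : ExpChar R q]
    (hq : q.Prime) : CharP R q := by
  cases h with
  | zero => exact absurd hq Nat.not_prime_one
  | prime hq' => assumption

/-- **Kuhlmann 2010, §5, proof of (R4), pp. 18–19, with Lemma 2.27 — PROVED**: the reduction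
to a finite tower of normal extensions of degree `p` over a finite unramified extension (see the
module docstring for the architecture of the proof; the `N` of the source is the inertia field
`T = L^I` of the separable closure `L` of `F` in the normal closure of `E|F`).
[cite: Kuhlmann2010, Section 5, proof of (R4) (pp. 18–19) and Lemma 2.27] -/
theorem Kuhlmann2010TameTowerReduction_holds : Kuhlmann2010TameTowerReduction.{u} := by
  intro Ω _ _ V p _ hp K F E hK hFC hFE hpos
  classical
  haveI : Fact p.Prime := ⟨hp⟩
  have hFh : IsHenselianField F (V.comap (algebraMap F Ω)) := hFC.isHenselianField
  have hKF : K ≤ F := hFC.base_le V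
  -- `E` and its normal closure `E₁` over `F`, finite normal inside `Ω`
  let E' : IntermediateField F Ω := Subfield.extendScalars hFE
  haveI : FiniteDimensional F E' := by
    have h := hpos
    rw [Subfield.relfinrank_eq_finrank_of_le hFE] at h
    exact Module.finite_of_finrank_pos h
  let E₁ : IntermediateField F Ω := normalClosure F E' Ω
  haveI : Normal F E₁ :=
    (Algebra.IsAlgebraic.isNormalClosure_normalClosure (F := F) (K := E') (L := Ω)
      (fun _ => IsAlgClosed.splits _)).normal
  haveI : FiniteDimensional F E₁ := normalClosure.is_finiteDimensional F E' Ω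
  have hE'E₁ : E' ≤ E₁ := IntermediateField.le_normalClosure E'
  -- the separable closure `L` of `F` in `E₁`: finite Galois over `F`
  let L : IntermediateField F Ω := lift (separableClosure F E₁)
  haveI : IsGalois F (separableClosure F E₁) := separableClosure.isGalois F E₁
  haveI : FiniteDimensional F L :=
    LinearEquiv.finiteDimensional (liftAlgEquiv (separableClosure F E₁)).toLinearEquiv
  haveI : IsGalois F L := IsGalois.of_algEquiv (liftAlgEquiv (separableClosure F E₁))
  -- `V` is stable under `Gal(L|F)`; the inertia group `I` is a `p`-group; `T = L^I` is unramified
  have hV : ∀ (σ : L ≃ₐ[F] L) (y : L), (y : Ω) ∈ V ↔ ((σ y : L) : Ω) ∈ V :=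
    forall_mem_iff_of_isHenselianField V hFh L
  obtain ⟨I, hI⟩ := exists_inertia_subgroup hV
  have hIp : IsPGroup p I := by
    refine isPGroup_of_inertia
      (fun ℓ hℓ hℓp => exists_isPrimitiveRoot_of_isAlgClosed V hp hK hKF hℓ hℓp)
      (fun y hy0 => ?_) I (fun σ hσ => (hI σ).mp hσ)
    have hy0' : (y : Ω) ≠ 0 := fun h => hy0 (by exact_mod_cast h)
    obtain ⟨c, hc, hyc⟩ := hFC.exists_valuation_eq_of_isAlgebraic V hK
      (Algebra.IsAlgebraic.isAlgebraic y).algebraMap hy0'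
    exact ⟨⟨c, hKF hc⟩, hyc.symm⟩
  have hunr : IsUnramifiedOver V F (lift (fixedField I)).toSubfield :=
    isUnramifiedOver_fixedField_inertia hV I hI hIp
  refine ⟨(lift (fixedField I)).toSubfield, hunr, ?_⟩
  -- the fields `T ≤ S₂ = L ∩ E.T ≤ M = E.T ≤ E₁`
  have hFT : F ≤ (lift (fixedField I)).toSubfield := hunr.le
  have hTL : (lift (fixedField I)).toSubfield ≤ L.toSubfield := lift_toSubfield_le (fixedField I)
  have hLE₁ : L.toSubfield ≤ E₁.toSubfield := fun z hz => lift_le _ hz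
  have hEE₁ : E ≤ E₁.toSubfield := fun z hz => hE'E₁ (show z ∈ E' from hz)
  have hTM : (lift (fixedField I)).toSubfield ≤ E ⊔ (lift (fixedField I)).toSubfield :=
    le_sup_right
  have hME₁ : E ⊔ (lift (fixedField I)).toSubfield ≤ E₁.toSubfield :=
    sup_le hEE₁ (hTL.trans hLE₁)
  have hTS₂ : (lift (fixedField I)).toSubfield ≤
      L.toSubfield ⊓ (E ⊔ (lift (fixedField I)).toSubfield) := le_inf hTL hTM
  have hS₂M : L.toSubfield ⊓ (E ⊔ (lift (fixedField I)).toSubfield) ≤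
      E ⊔ (lift (fixedField I)).toSubfield := inf_le_right
  -- degrees are finite
  have hFE₁pos : 0 < Subfield.relfinrank F E₁.toSubfield := by
    rw [relfinrank_toSubfield_eq_finrank]; exact finrank_pos
  have hFMpos : 0 < Subfield.relfinrank F (E ⊔ (lift (fixedField I)).toSubfield) := by
    rw [← Subfield.relfinrank_mul_relfinrank (hFT.trans hTM) hME₁] at hFE₁pos
    exact Nat.pos_of_ne_zero (left_ne_zero_of_mul hFE₁pos.ne')
  have hS₂Mpos : 0 < Subfield.relfinrank
      (L.toSubfield ⊓ (E ⊔ (lift (fixedField I)).toSubfield))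
      (E ⊔ (lift (fixedField I)).toSubfield) := by
    rw [← Subfield.relfinrank_mul_relfinrank (hFT.trans hTS₂) hS₂M] at hFMpos
    exact Nat.pos_of_ne_zero (right_ne_zero_of_mul hFMpos.ne')
  -- (1) the tower of Galois steps from `T` to `S₂`: `L|T` is Galois with `p`-group `I`
  haveI := finiteDimensional_extendScalars_lift (fixedField I)
  haveI := isGalois_extendScalars_lift (fixedField I)
  have hP : IsPGroup p (Subfield.extendScalars (lift_toSubfield_le (fixedField I))
      ≃ₐ[(lift (fixedField I)).toSubfield]
        Subfield.extendScalars (lift_toSubfield_le (fixedField I))) :=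
    isPGroup_extendScalars_lift (fixedField I)
      (by rw [IntermediateField.fixingSubgroup_fixedField]; exact hIp)
  have hS₂' : Subfield.extendScalars hTS₂ ≤
      Subfield.extendScalars (lift_toSubfield_le (fixedField I)) :=
    fun z hz => (inf_le_left : L.toSubfield ⊓ (E ⊔ (lift (fixedField I)).toSubfield) ≤ _) hz
  have h1 : IsNormalPTower p (lift (fixedField I)).toSubfield
      (L.toSubfield ⊓ (E ⊔ (lift (fixedField I)).toSubfield)) := by
    have h := isNormalPTower_of_isGalois_of_isPGroup (p := p) _ (lift (fixedField I)).toSubfield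
      (Subfield.extendScalars (lift_toSubfield_le (fixedField I))) hP rfl
      (IntermediateField.restrict hS₂')
    rwa [lift_restrict, Subfield.extendScalars_toSubfield] at h
  -- (2) the tower of purely inseparable steps from `S₂` to `M = E.T`:
  -- `E₁|L` is purely inseparable
  have h2 : IsNormalPTower p (L.toSubfield ⊓ (E ⊔ (lift (fixedField I)).toSubfield))
      (E ⊔ (lift (fixedField I)).toSubfield) := by
    have hpow : ∀ z ∈ E ⊔ (lift (fixedField I)).toSubfield, ∃ k : ℕ,
        z ^ ringExpChar Ω ^ k ∈ L.toSubfield ⊓ (E ⊔ (lift (fixedField I)).toSubfield) := by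
      intro z hz
      have hz₁ : z ∈ E₁ := hME₁ hz
      obtain ⟨k, w, hw⟩ :=
        IsPurelyInseparable.pow_mem (separableClosure F E₁) (ringExpChar Ω)
          (⟨z, hz₁⟩ : E₁)
      refine ⟨k, Subfield.mem_inf.mpr ⟨?_, Subfield.pow_mem _ hz _⟩⟩
      have h3 : ((w : E₁) : Ω) = z ^ ringExpChar Ω ^ k := by
        have h4 := congrArg (fun t : E₁ => (t : Ω)) hw
        simpa using h4
      change z ^ ringExpChar Ω ^ k ∈ lift (separableClosure F E₁)
      rw [← h3]
      exact (mem_lift (w : E₁)).mpr w.2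
    rcases expChar_is_prime_or_one Ω (ringExpChar Ω) with hqprime | hq1
    · haveI : CharP Ω (ringExpChar Ω) := charP_of_expChar_of_prime (ringExpChar Ω) hqprime
      have hqp : ringExpChar Ω = p := eq_residueChar_of_charP V hp hqprime
      haveI : CharP Ω p := hqp ▸ (inferInstance : CharP Ω (ringExpChar Ω))
      rw [hqp] at hpow
      exact isNormalPTower_of_forall_pow_mem _ _ _ hS₂M hpow rfl hS₂Mpos
    · have hMS₂ : E ⊔ (lift (fixedField I)).toSubfield ≤
          L.toSubfield ⊓ (E ⊔ (lift (fixedField I)).toSubfield) := fun z hz => by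
        obtain ⟨k, hk⟩ := hpow z hz
        rwa [hq1, one_pow, pow_one] at hk
      rw [le_antisymm hS₂M hMS₂]
      exact IsNormalPTower.refl _
  exact h1.trans h2

end Literature.AlgebraicGeometry.Resolution
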